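import Summits.BirchSwinnertonDyer.BirchSwinnertonDyer.Theorems.SignedLowerHalvesSmallImageLowerHalfBothSignsRttCharRoadE1DescComposite
import Summits.BirchSwinnertonDyer.BirchSwinnertonDyer.Theorems.SignedLowerHalvesSmallImageLowerHalfBothSignsRttCharRoadE1CorTower
import HarnessLib

/-!
# Route `SignedLowerHalves`, crux L `SmallImageLowerHalfBothSigns` (stmt-BirchSwinnertonDyer-23599), line `rtt_w3` v12 — glue `charRoad_injTop`,
# LEAD: block DESC AT LEVEL `∞` (the coordinate classes of `injTop_of_inputs` live on `Γ_{ℚ_∞}`)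

WHY: the composition `injTop_of_inputs` (INPUT SPEC, bus 2026-08-30) defines the coordinates of a class `s ∈ Sel^{sat}_∞(θ)[π]` canonically at
level `∞`: `Ψ(s) = cor_∞ (e_∞^* (subgroupH1Iso (res_= (res^{K_n}_{K_∞} y))))` for a layer-`n` representative `y`. This file moves -w3 g18's
layer-`n` composite `desc_resOfLe_corH1_mem_acSignedSelmer` (p768739 = p767713 + p768350 + p767739) to that shape: (1) `comapResGal_kerSubgroup_inf_galRange`
(`res⁻¹(Γ_{ℚ_∞} ∩ Γ_K) = Γ_{K_∞}`); (2) ★ `resH1Hom_incN_eq_resOfLe_infty` (the cores data at layer `n` and at `∞` are compatible: both sides are ONE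
`resH1Hom` along group maps with the same underlying elements of `Γ_K`); (3) ★★ `corH1_infty_mem_acSignedSelmer` (membership + `p`-torsion of the
`∞`-level class, via the LEAD's `resOfLe_corH1_eq_corH1_resH1Hom` (p768913) for the SHARED local transversal `c ∈ localSubgroupOfEmb κ.kerSubgroup ι`).
THEOREMS ONLY. [cite: Kobayashi2003, Def. 1.1] [cite: BDKim2009, pp. 182, 185] [cite: NeukirchSchmidtWingberg2008, I §5 (1.5.7)] [cite: SerreGaloisCohomology1997, I §2.4]
-/

set_option linter.dupNamespace false -- D-0017: single-problem summit, the namespace repeats the problem name by design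

noncomputable section

open scoped Classical

namespace Summit.BirchSwinnertonDyer.BirchSwinnertonDyer.Theorems.SmallImageCharSignedSelmer

open NumberField IsDedekindDomain Field Literature.NumberTheory.EllipticCurves Literature.NumberTheory.GaloisRepresentations
  Literature.NumberTheory.EllipticCurves.GreenbergSelmer Literature.NumberTheory.EllipticCurves.GreenbergVatsal2000
  Summit.BirchSwinnertonDyer.Rank1Residual.Additive.LocalTransport Summit.BirchSwinnertonDyer.Rank1Residual.Additive.BaseChange
  Literature.NumberTheory.EllipticCurves.AcSigned WeierstrassCurve Rat.HeightOneSpectrum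

section KerLevel

variable {k : Type} [Field k] [NumberField k] {p : ℕ} [hp : Fact p.Prime] (hp2 : p ≠ 2) (κ : ZpExtension k p)
  (K : Type) [Field K] [NumberField K] [Algebra k K] (hK2 : Module.finrank k K = 2)

/-- **`res⁻¹(Γ_{k_∞} ∩ galRange K) = Γ_{K_∞}`** for the restricted `ℤ_p`-extension (companion of `comapResGal_layerSubgroup_inf_galRange`).
[cite: Washington1997, §13.1] -/
theorem comapResGal_kerSubgroup_inf_galRange :
    comapResGal K (κ.kerSubgroup ⊓ galRange (K := k) K) = (κ.restrictOfFinrankEqTwo hp2 K hK2).kerSubgroup := by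
  ext τ
  rw [mem_comapResGal_iff, Subgroup.mem_inf, ZpExtension.restrictOfFinrankEqTwo, ZpExtension.kerSubgroup_restrict, Subgroup.mem_comap]
  exact ⟨fun h ↦ h.1, fun h ↦ ⟨h, (mem_galRange_iff K _).2 ⟨τ, rfl⟩⟩⟩

end KerLevel

section Infty

variable (K : Type) [Field K] [NumberField K] (hK2 : Module.finrank ℚ K = 2) {p : ℕ} [hp : Fact p.Prime] (hp2 : p ≠ 2)
  (κ : ZpExtension ℚ p) (W : WeierstrassCurve ℚ) (n : ℕ)
  (e : ((galRange (K := ℚ) K).subgroupOf (κ.layerSubgroup n)) →ₜ* (κ.layerSubgroup n ⊓ galRange (K := ℚ) K : Subgroup (absoluteGaloisGroup ℚ)))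
  (he : ∀ x : (galRange (K := ℚ) K).subgroupOf (κ.layerSubgroup n),
    ((e x : (κ.layerSubgroup n ⊓ galRange (K := ℚ) K : Subgroup (absoluteGaloisGroup ℚ))) : absoluteGaloisGroup ℚ) =
      ((x : κ.layerSubgroup n) : absoluteGaloisGroup ℚ))
  (einf : ((galRange (K := ℚ) K).subgroupOf κ.kerSubgroup) →ₜ* (κ.kerSubgroup ⊓ galRange (K := ℚ) K : Subgroup (absoluteGaloisGroup ℚ)))
  (heinf : ∀ x : (galRange (K := ℚ) K).subgroupOf κ.kerSubgroup,
    ((einf x : (κ.kerSubgroup ⊓ galRange (K := ℚ) K : Subgroup (absoluteGaloisGroup ℚ))) : absoluteGaloisGroup ℚ) =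
      ((x : κ.kerSubgroup) : absoluteGaloisGroup ℚ))
  (incN : ((galRange (K := ℚ) K).subgroupOf κ.kerSubgroup) →ₜ* ((galRange (K := ℚ) K).subgroupOf (κ.layerSubgroup n)))
  (hincN : ∀ x : (galRange (K := ℚ) K).subgroupOf κ.kerSubgroup,
    ((incN x : (galRange (K := ℚ) K).subgroupOf (κ.layerSubgroup n)) : κ.layerSubgroup n) =
      Subgroup.inclusion (κ.kerSubgroup_le_layerSubgroup n) (x : κ.kerSubgroup))

include he heinf hincN in
/-- ★ **Layer-`n` and level-`∞` cores data are compatible**: restricting `e_n^* (subgroupH1Iso (res_= y))` along `incN : N_∞ → N_n` equals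
`e_∞^* (subgroupH1Iso (res_= (res^{K_n}_{K_∞} y)))` — both are one `resH1Hom` along group maps `N_∞ → Γ_{K_n}` with the same values in `Γ_K`.
[cite: SerreGaloisCohomology1997, I §2.4] -/
theorem resH1Hom_incN_eq_resOfLe_infty
    (hincM : ∀ (x : (galRange (K := ℚ) K).subgroupOf κ.kerSubgroup) (m : W.geomPrimaryTorsion p),
      AddMonoidHom.id (W.geomPrimaryTorsion p) (incN x • m) = x • AddMonoidHom.id (W.geomPrimaryTorsion p) m)
    (y : (W.baseChange K).subgroupH1 p ((κ.restrictOfFinrankEqTwo hp2 K hK2).layerSubgroup n)) :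
    resH1Hom incN (AddMonoidHom.id (W.geomPrimaryTorsion p)) hincM
        (resH1Hom e (AddMonoidHom.id (W.geomPrimaryTorsion p)) (smul_eq_smul_of_coe_eq W p (κ.layerSubgroup n) (galRange (K := ℚ) K) e he)
          (subgroupH1Iso K W p (inf_le_right : κ.layerSubgroup n ⊓ galRange (K := ℚ) K ≤ galRange (K := ℚ) K)
            ((W.baseChange K).resOfLe p (le_of_eq (comapResGal_layerSubgroup_inf_galRange hp2 κ K hK2 n)) y))) =
      resH1Hom einf (AddMonoidHom.id (W.geomPrimaryTorsion p)) (smul_eq_smul_of_coe_eq W p κ.kerSubgroup (galRange (K := ℚ) K) einf heinf)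
        (subgroupH1Iso K W p (inf_le_right : κ.kerSubgroup ⊓ galRange (K := ℚ) K ≤ galRange (K := ℚ) K)
          ((W.baseChange K).resOfLe p (le_of_eq (comapResGal_kerSubgroup_inf_galRange hp2 κ K hK2))
            ((W.baseChange K).resOfLe p ((κ.restrictOfFinrankEqTwo hp2 K hK2).kerSubgroup_le_layerSubgroup n) y))) := by
  rw [subgroupH1Iso_apply, subgroupH1Iso_apply, WeierstrassCurve.resOfLe, WeierstrassCurve.resOfLe, WeierstrassCurve.resOfLe,
    Literature.NumberTheory.EllipticCurves.resOfLe, Literature.NumberTheory.EllipticCurves.resOfLe,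
    Literature.NumberTheory.EllipticCurves.resOfLe, resH1Hom_resH1Hom, resH1Hom_resH1Hom, resH1Hom_resH1Hom, resH1Hom_resH1Hom,
    resH1Hom_resH1Hom, resH1Hom_resH1Hom]
  refine DFunLike.congr_fun (resH1Hom_congr (ContinuousMonoidHom.ext fun x ↦ ?_) (AddMonoidHom.ext fun _ ↦ rfl) _ _) y
  -- the two group maps `N_∞ → Γ_{K_n}` have the same values in `Γ_K` (compare after `resGal K`)
  apply Subtype.ext
  apply resGal_injective (K := ℚ) K
  change resGal (K := ℚ) K ((subgroupToComap K (inf_le_right : κ.layerSubgroup n ⊓ galRange (K := ℚ) K ≤ galRange (K := ℚ) K)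
      (e (incN x)) : comapResGal K (κ.layerSubgroup n ⊓ galRange (K := ℚ) K)) : absoluteGaloisGroup K) =
    resGal (K := ℚ) K ((subgroupToComap K (inf_le_right : κ.kerSubgroup ⊓ galRange (K := ℚ) K ≤ galRange (K := ℚ) K) (einf x) :
      comapResGal K (κ.kerSubgroup ⊓ galRange (K := ℚ) K)) : absoluteGaloisGroup K)
  rw [resGal_subgroupToComap, resGal_subgroupToComap, he (incN x), heinf x, hincN x]
  rfl

variable (hκ : κ.IsCyclotomic) (v₀ : HeightOneSpectrum (𝓞 ℚ)) (hv₀ : ((p : ℕ) : 𝓞 ℚ) ∈ v₀.asIdeal)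
  (w : HeightOneSpectrum (𝓞 K)) [w.asIdeal.LiesOver v₀.asIdeal]
  (ι : AlgebraicClosure ℚ →ₐ[ℚ] AlgebraicClosure (v₀.adicCompletion ℚ))
  (ι₂ : AlgebraicClosure (v₀.adicCompletion ℚ) ≃+* AlgebraicClosure (w.adicCompletion K))
  (hcompat : ∀ z : AlgebraicClosure ℚ, closureEmb (K := K) (w.adicCompletion K) (closureEmb (K := ℚ) K z) = ι₂ (ι z))
  (hι₂ : ∀ y : v₀.adicCompletion ℚ, ι₂ (algebraMap (v₀.adicCompletion ℚ) (AlgebraicClosure (v₀.adicCompletion ℚ)) y) =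
    algebraMap (w.adicCompletion K) (AlgebraicClosure (w.adicCompletion K)) (adicCompletionMap (K := ℚ) K v₀ w y))
  (hfixU : ∀ h : absoluteGaloisGroup (v₀.adicCompletion ℚ), resGalOfEmb ι h ∈ galRange (K := ℚ) K → ∀ y : w.adicCompletion K,
    (show AlgebraicClosure (v₀.adicCompletion ℚ) ≃ₐ[v₀.adicCompletion ℚ] AlgebraicClosure (v₀.adicCompletion ℚ) from h)
        (ι₂.symm (algebraMap (w.adicCompletion K) (AlgebraicClosure (w.adicCompletion K)) y)) =
      ι₂.symm (algebraMap (w.adicCompletion K) (AlgebraicClosure (w.adicCompletion K)) y))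
  [W.IsElliptic] (ε : ℤˣ) [((galRange (K := ℚ) K).subgroupOf (κ.layerSubgroup n)).Normal] [((galRange (K := ℚ) K).subgroupOf κ.kerSubgroup).Normal]
  (𝔪 : Ideal (𝓞 K)) (hbad : ∀ (ℓ : ℕ) [Fact ℓ.Prime], ℓ ∣ (NumberField.discr K).natAbs * Ideal.absNorm 𝔪 → ¬ W.HasGoodReductionAtPrime ℓ)
  (S₀ : Finset (HeightOneSpectrum (𝓞 ℚ))) (hS₀bad : ∀ v : HeightOneSpectrum (𝓞 ℚ), ¬ W.HasGoodReductionAt v → v ∈ S₀)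

/-- The shared local transversal lies in every layer's local subgroup (bookkeeping). [folklore] -/
theorem mem_localSubgroupOfEmb_layerSubgroup_of_kerSubgroup {c : absoluteGaloisGroup (v₀.adicCompletion ℚ)}
    (hc : c ∈ localSubgroupOfEmb κ.kerSubgroup ι) : c ∈ localSubgroupOfEmb (κ.layerSubgroup n) ι :=
  (mem_localSubgroupOfEmb_iff _ _ _).2 (κ.kerSubgroup_le_layerSubgroup n ((mem_localSubgroupOfEmb_iff _ _ _).1 hc))

include hκ hv₀ hcompat hι₂ hfixU hbad hS₀bad he heinf hincN in
/-- ★★ **Block DESC at level `∞`.** For a layer-`n` class `y ∈ H¹(Γ_{K_n}, W_K[p^∞])` killed by `p`, in Kobayashi's condition at `closureEmb K_w` and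
unramified outside `S₀K ∪ {p}`, the LEVEL-`∞` class `cor_∞ (e_∞^* (subgroupH1Iso (res_= (res^{K_n}_{K_∞} y))))` (corestriction along the index-two pair
`Γ_{K_∞} ≤ Γ_{ℚ_∞}` with the SHARED local transversal `c`) lies in `AcSigned.selmer W p κ ↑S₀ (fun _ ↦ .sgn ε)` and is killed by `p`: it equals
`res_{ℚ_∞} (cor_n (…))` by p768913 and `resH1Hom_incN_eq_resOfLe_infty`, and that class is g18's p768739.
[cite: Kobayashi2003, Def. 1.1] [cite: BDKim2009, pp. 182, 185] [cite: NeukirchSchmidtWingberg2008, I §5 (1.5.7)] -/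
theorem corH1_infty_mem_acSignedSelmer
    {c : absoluteGaloisGroup (v₀.adicCompletion ℚ)} (hc : c ∈ localSubgroupOfEmb κ.kerSubgroup ι) (hcU : resGalOfEmb ι c ∉ galRange (K := ℚ) K)
    (hNn : IsOpen (((galRange (K := ℚ) K).subgroupOf (κ.layerSubgroup n) : Subgroup (κ.layerSubgroup n)) : Set (κ.layerSubgroup n)))
    (hNinf : IsOpen (((galRange (K := ℚ) K).subgroupOf κ.kerSubgroup : Subgroup κ.kerSubgroup) : Set κ.kerSubgroup))
    (hMn : ∀ m : W.geomPrimaryTorsion p, Continuous fun g : κ.layerSubgroup n ↦ g • m)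
    (hMinf : ∀ m : W.geomPrimaryTorsion p, Continuous fun g : κ.kerSubgroup ↦ g • m)
    (hopen : IsOpen ((κ.layerSubgroup n ⊓ galRange (K := ℚ) K : Subgroup (absoluteGaloisGroup ℚ)) : Set (absoluteGaloisGroup ℚ)))
    (y : (W.baseChange K).subgroupH1 p ((κ.restrictOfFinrankEqTwo hp2 K hK2).layerSubgroup n)) (hyp : p • y = 0)
    (hy : y ∈ Kobayashi2003.localKummerOverOfEmb (W.baseChange K) p ((κ.restrictOfFinrankEqTwo hp2 K hK2).layerSubgroup n)
      (closureEmb (K := K) (w.adicCompletion K))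
      (Kobayashi2003.signedLocalPointsOfEmb (κ.restrictOfFinrankEqTwo hp2 K hK2) (closureEmb (K := K) (w.adicCompletion K)) (W.baseChange K) ε n))
    (hyunr : y ∈ unramifiedOutside ((κ.restrictOfFinrankEqTwo hp2 K hK2).layerSubgroup n) ((W.baseChange K).geomPrimaryTorsion p) p
      {w' : HeightOneSpectrum (𝓞 K) | ∃ v ∈ S₀, ((natGenerator v : ℕ) : 𝓞 K) ∈ w'.asIdeal}) :
    corH1 hNinf hMinf (xor_mem_subgroupOf_of_index_two κ.kerSubgroup (galRange (K := ℚ) K) ι (index_galRange_eq_two K hK2) hc hcU)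
        (resH1Hom einf (AddMonoidHom.id (W.geomPrimaryTorsion p)) (smul_eq_smul_of_coe_eq W p κ.kerSubgroup (galRange (K := ℚ) K) einf heinf)
          (subgroupH1Iso K W p (inf_le_right : κ.kerSubgroup ⊓ galRange (K := ℚ) K ≤ galRange (K := ℚ) K)
            ((W.baseChange K).resOfLe p (le_of_eq (comapResGal_kerSubgroup_inf_galRange hp2 κ K hK2))
              ((W.baseChange K).resOfLe p ((κ.restrictOfFinrankEqTwo hp2 K hK2).kerSubgroup_le_layerSubgroup n) y)))) ∈
        selmer W p κ (S₀ : Set (HeightOneSpectrum (𝓞 ℚ))) (fun _ ↦ PCond.sgn ε) ∧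
      p • corH1 hNinf hMinf (xor_mem_subgroupOf_of_index_two κ.kerSubgroup (galRange (K := ℚ) K) ι (index_galRange_eq_two K hK2) hc hcU)
        (resH1Hom einf (AddMonoidHom.id (W.geomPrimaryTorsion p)) (smul_eq_smul_of_coe_eq W p κ.kerSubgroup (galRange (K := ℚ) K) einf heinf)
          (subgroupH1Iso K W p (inf_le_right : κ.kerSubgroup ⊓ galRange (K := ℚ) K ≤ galRange (K := ℚ) K)
            ((W.baseChange K).resOfLe p (le_of_eq (comapResGal_kerSubgroup_inf_galRange hp2 κ K hK2))
              ((W.baseChange K).resOfLe p ((κ.restrictOfFinrankEqTwo hp2 K hK2).kerSubgroup_le_layerSubgroup n) y)))) = 0 := by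
  have hcn : c ∈ localSubgroupOfEmb (κ.layerSubgroup n) ι := mem_localSubgroupOfEmb_layerSubgroup_of_kerSubgroup κ n v₀ ι hc
  have hincM : ∀ (x : (galRange (K := ℚ) K).subgroupOf κ.kerSubgroup) (m : W.geomPrimaryTorsion p),
      AddMonoidHom.id (W.geomPrimaryTorsion p) (incN x • m) = x • AddMonoidHom.id (W.geomPrimaryTorsion p) m := fun x m ↦ by
    rw [AddMonoidHom.id_apply, AddMonoidHom.id_apply, Subgroup.smul_def, Subgroup.smul_def, Subgroup.smul_def, Subgroup.smul_def, hincN,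
      Subgroup.coe_inclusion]
  refine ⟨?_, by rw [← map_nsmul, ← map_nsmul, ← map_nsmul, ← map_nsmul, ← map_nsmul, hyp, map_zero, map_zero, map_zero, map_zero, map_zero]⟩
  have hmem := desc_resOfLe_corH1_mem_acSignedSelmer K hK2 hp2 κ hκ v₀ hv₀ w ι ι₂ hcompat hι₂ hfixU W ε n 𝔪 hbad S₀ hS₀bad e he hcn hcU
    hNn hMn hopen y hyp hy hyunr
  -- `res_{ℚ_∞} ∘ cor_n = cor_∞ ∘ res` for the shared transversal (p768913)
  have hA := resOfLe_corH1_eq_corH1_resH1Hom (Γ := absoluteGaloisGroup ℚ) (M := W.geomPrimaryTorsion p) (κ.kerSubgroup_le_layerSubgroup n)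
    (c := resGalSubgroupOfEmb (κ.layerSubgroup n) ι ⟨c, hcn⟩) (c' := resGalSubgroupOfEmb κ.kerSubgroup ι ⟨c, hc⟩) rfl hNn hNinf hMn hMinf
    (xor_mem_subgroupOf_of_index_two (κ.layerSubgroup n) (galRange (K := ℚ) K) ι (index_galRange_eq_two K hK2) hcn hcU)
    (xor_mem_subgroupOf_of_index_two κ.kerSubgroup (galRange (K := ℚ) K) ι (index_galRange_eq_two K hK2) hc hcU)
    (fun b ↦ by rw [Subgroup.mem_subgroupOf, Subgroup.mem_subgroupOf, Subgroup.coe_inclusion]) incN hincN hincM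
    (resH1Hom e (AddMonoidHom.id (W.geomPrimaryTorsion p)) (smul_eq_smul_of_coe_eq W p (κ.layerSubgroup n) (galRange (K := ℚ) K) e he)
      (subgroupH1Iso K W p (inf_le_right : κ.layerSubgroup n ⊓ galRange (K := ℚ) K ≤ galRange (K := ℚ) K)
        ((W.baseChange K).resOfLe p (le_of_eq (comapResGal_layerSubgroup_inf_galRange hp2 κ K hK2 n)) y)))
  rw [resH1Hom_incN_eq_resOfLe_infty K hK2 hp2 κ W n e he einf heinf incN hincN hincM y] at hA
  rw [← hA]
  exact hmem

end Infty

end Summit.BirchSwinnertonDyer.BirchSwinnertonDyer.Theorems.SmallImageCharSignedSelmer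

end
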